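import Summits.NavierStokesRegularity.NavierStokesRegularity.Theorems.PerpetualPumpAveragedTypeIBlowupChainContinuationTools
import Mathlib.Analysis.Calculus.ParametricIntervalIntegral
import Mathlib.Analysis.Calculus.MeanValue
import Mathlib.Analysis.Calculus.Deriv.Shift
import Mathlib.MeasureTheory.Integral.IntervalIntegral.FundThmCalculus

/-!
# Crux `PerpetualPump.AveragedTypeIBlowup` (stmt-NavierStokesRegularity-1835), line `Sketch`:
# the stub `chainODE` — the exact Volterra chain solves the cascade ODE with central damping

T. Tao, *Finite time blowup for an averaged three-dimensional Navier–Stokes equation*, J. Amer.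
Math. Soc. **29** (2016), 601–674 = arXiv:1402.0290v3, §4, p. 22 (4.14): pairing the wavelet
Duhamel formula with `ψ_{i,n}` gives the exact Volterra chain of the coefficients,
`Y_{i,n}(t) = A 1_{(i,n)=(i₀,n₀)} k_{i,n}(t) + ∫₀ᵗ k_{i,n}(t-s) quadTerm(Y)_{i,n}(s) ds`.

This file proves the registered stub `stub_chainODE` of the lead's skeleton
`Cruxes/AveragedTypeIBlowup/Lines/Sketch.lean` (abstract kernels): if the kernels `k_{i,n}` are
`C¹` on `ℝ` with `k_{i,n}(0) = 1` and a pinched logarithmic derivative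
`D⁻ₙ k ≤ -k' ≤ D⁺ₙ k`, `k ≥ 0` on `τ ≥ 0`, then every continuous solution `Y` of the chain on
`[0,S)` is differentiable on `(0,S)` and
`|Y' + ½(D⁻ₙ+D⁺ₙ) Y - Q| ≤ ½(D⁺ₙ-D⁻ₙ) (|A 1| k(t) + ∫₀ᵗ k(t-s) |Q(s)| ds)`, `Q = quadTerm(Y)_{i,n}`.

The analytic input is the Leibniz rule for a Volterra convolution with a `C¹` kernel and a
continuous density (`hasDerivAt_volterra_kernel`):
`d/dt ∫ₐᵗ k(t-s) q(s) ds = k(0) q(t) + ∫ₐᵗ k'(t-s) q(s) ds`, proved by splitting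
`∫ₐᵗ k(t-s)q = ∫ₐ^{t₀} k(t-s)q + ∫ₐᵗ k(t₀-s)q + ∫_{t₀}ᵗ (k(t-s)-k(t₀-s))q - ∫ₐ^{t₀} k(t₀-s)q`:
the first term is differentiated under the integral sign
(`intervalIntegral.hasDerivAt_integral_of_dominated_loc_of_deriv_le`), the second by the
fundamental theorem of calculus, and the third is `O((t-t₀)²)` by the mean value inequality.
The drive `Q` is only continuous on `[0,S)`; it is clamped to `[0,T]`, `t < T < S`, to a continuous
function on `ℝ` agreeing with `Q` near `t`, and `HasDerivAt` is transferred along the eventual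
equality given by the chain identity.

Nothing here closes the item (`--supports`); no statement of the route changes.

## References

* T. Tao, J. Amer. Math. Soc. 29 (2016), 601–674, arXiv:1402.0290v3, §4 p. 22 (4.14).
  [`Tao2016AveragedNS`]
-/

noncomputable section

-- the summit namespace `…NavierStokesRegularity.NavierStokesRegularity…` is the tree convention
set_option linter.dupNamespace false

open MeasureTheory Set Filter Topology
open scoped ENNReal
open Literature.Analysis.FluidPDE
open Literature.Analysis.FluidPDE.TaoCascade (quadTerm)

namespace Summit.NavierStokesRegularity.NavierStokesRegularity.Theorems.PerpetualPumpAveragedTypeIBlowup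

/-! ### Calculus of Volterra convolutions with a `C¹` kernel -/

/-- **Differentiation under the integral sign** for a `C¹` kernel against a continuous density on
a fixed interval: `d/du ∫ₐᵇ k(u-s) q(s) ds = ∫ₐᵇ k'(u-s) q(s) ds` (domination by
`sup |k'| · |q|` on a compact range of `u - s`). [folklore] -/
theorem hasDerivAt_integral_kernel_sub_mul {k k₁ q : ℝ → ℝ} (hk : ∀ τ, HasDerivAt k (k₁ τ) τ)
    (hk₁ : Continuous k₁) (hq : Continuous q) (a b u₀ : ℝ) :
    HasDerivAt (fun u => ∫ s in a..b, k (u - s) * q s) (∫ s in a..b, k₁ (u₀ - s) * q s) u₀ := by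
  have hkc : Continuous k := continuous_iff_continuousAt.2 fun τ => (hk τ).continuousAt
  obtain ⟨C, hC⟩ := (isCompact_Icc (a := u₀ - 1 - max a b) (b := u₀ + 1 - min a b)).exists_bound_of_continuousOn
    hk₁.continuousOn
  refine (intervalIntegral.hasDerivAt_integral_of_dominated_loc_of_deriv_le (μ := volume)
    (F := fun u s => k (u - s) * q s) (F' := fun u s => k₁ (u - s) * q s) (x₀ := u₀) (a := a)
    (b := b) (bound := fun s => |C| * |q s|)
    (Icc_mem_nhds (show u₀ - 1 < u₀ by linarith) (show u₀ < u₀ + 1 by linarith))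
    (Eventually.of_forall fun u =>
      ((hkc.comp (continuous_const.sub continuous_id)).mul hq).aestronglyMeasurable)
    (((hkc.comp (continuous_const.sub continuous_id)).mul hq).intervalIntegrable _ _)
    ((hk₁.comp (continuous_const.sub continuous_id)).mul hq).aestronglyMeasurable
    (Eventually.of_forall fun s hs u hu => ?_)
    ((continuous_const.mul (continuous_abs.comp hq)).intervalIntegrable _ _)
    (Eventually.of_forall fun s _ u _ => ((hk (u - s)).comp_sub_const u s).mul_const (q s))).2
  rw [Real.norm_eq_abs, abs_mul]
  refine mul_le_mul_of_nonneg_right ?_ (abs_nonneg _)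
  have hus : u - s ∈ Icc (u₀ - 1 - max a b) (u₀ + 1 - min a b) := by
    rcases mem_uIoc.1 hs with ⟨h1, h2⟩ | ⟨h1, h2⟩ <;>
      exact ⟨by linarith [hu.1, hu.2, le_max_left a b, le_max_right a b, min_le_left a b,
          min_le_right a b],
        by linarith [hu.1, hu.2, le_max_left a b, le_max_right a b, min_le_left a b,
          min_le_right a b]⟩
  exact (hC _ hus).trans (le_abs_self C)

/-- **Leibniz rule for a Volterra convolution**: for a `C¹` kernel `k` (derivative `k'`
continuous) and a continuous density `q`,
`d/dt ∫ₐᵗ k(t-s) q(s) ds = k(0) q(t) + ∫ₐᵗ k'(t-s) q(s) ds` at every `t`. [folklore] -/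
theorem hasDerivAt_volterra_kernel {k k₁ q : ℝ → ℝ} (hk : ∀ τ, HasDerivAt k (k₁ τ) τ)
    (hk₁ : Continuous k₁) (hq : Continuous q) (a t₀ : ℝ) :
    HasDerivAt (fun t => ∫ s in a..t, k (t - s) * q s)
      (k 0 * q t₀ + ∫ s in a..t₀, k₁ (t₀ - s) * q s) t₀ := by
  have hkc : Continuous k := continuous_iff_continuousAt.2 fun τ => (hk τ).continuousAt
  have hint : ∀ u b c : ℝ, IntervalIntegrable (fun s => k (u - s) * q s) volume b c :=
    fun u b c => ((hkc.comp (continuous_const.sub continuous_id)).mul hq).intervalIntegrable _ _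
  -- (1) frozen kernel, moving endpoint: the fundamental theorem of calculus
  have h1 : HasDerivAt (fun t => ∫ s in a..t, k (t₀ - s) * q s) (k (t₀ - t₀) * q t₀) t₀ :=
    (((hkc.comp (continuous_const.sub continuous_id)).mul hq).integral_hasStrictDerivAt
      a t₀).hasDerivAt
  -- (2) moving kernel, frozen endpoint: differentiation under the integral sign
  have h2 := hasDerivAt_integral_kernel_sub_mul hk hk₁ hq a t₀ t₀
  -- (3) the cross remainder is `O((t - t₀)²)`
  have h3 : HasDerivAt (fun t => ∫ s in t₀..t, (k (t - s) - k (t₀ - s)) * q s) 0 t₀ := by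
    obtain ⟨K, hK⟩ :=
      (isCompact_Icc (a := (-1 : ℝ)) (b := 1)).exists_bound_of_continuousOn hk₁.continuousOn
    obtain ⟨M, hM⟩ :=
      (isCompact_Icc (a := t₀ - 1) (b := t₀ + 1)).exists_bound_of_continuousOn hq.continuousOn
    rw [hasDerivAt_iff_isLittleO]
    simp only [intervalIntegral.integral_same, smul_zero, sub_zero]
    refine Asymptotics.IsBigO.trans_isLittleO ?_ (Asymptotics.isLittleO_pow_sub_sub t₀ one_lt_two)
    refine Asymptotics.IsBigO.of_bound (|K| * |M|) ?_
    filter_upwards [Icc_mem_nhds (show t₀ - 1 < t₀ by linarith) (show t₀ < t₀ + 1 by linarith)]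
      with t ht
    have hbound : ∀ s ∈ uIoc t₀ t, ‖(k (t - s) - k (t₀ - s)) * q s‖ ≤ |K| * |t - t₀| * |M| := by
      intro s hs
      have hs' : t - s ∈ Icc (-1 : ℝ) 1 ∧ t₀ - s ∈ Icc (-1 : ℝ) 1 ∧ s ∈ Icc (t₀ - 1) (t₀ + 1) := by
        rcases mem_uIoc.1 hs with ⟨hs1, hs2⟩ | ⟨hs1, hs2⟩ <;>
          exact ⟨⟨by linarith [ht.1, ht.2], by linarith [ht.1, ht.2]⟩,
            ⟨by linarith [ht.1, ht.2], by linarith [ht.1, ht.2]⟩,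
            ⟨by linarith [ht.1, ht.2], by linarith [ht.1, ht.2]⟩⟩
      have hmv : ‖k (t - s) - k (t₀ - s)‖ ≤ |K| * ‖(t - s) - (t₀ - s)‖ :=
        (convex_Icc (-1 : ℝ) 1).norm_image_sub_le_of_norm_hasDerivWithin_le (f := k) (f' := k₁)
          (fun x _ => (hk x).hasDerivWithinAt) (fun x hx => (hK x hx).trans (le_abs_self K))
          hs'.2.1 hs'.1
      have hts : ‖(t - s) - (t₀ - s)‖ = |t - t₀| := by
        rw [Real.norm_eq_abs]; congr 1; ring
      rw [hts] at hmv
      rw [norm_mul]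
      exact mul_le_mul hmv ((hM s hs'.2.2).trans (le_abs_self M)) (norm_nonneg _) (by positivity)
    calc ‖∫ s in t₀..t, (k (t - s) - k (t₀ - s)) * q s‖
        ≤ |K| * |t - t₀| * |M| * |t - t₀| := intervalIntegral.norm_integral_le_of_norm_le_const hbound
      _ = |K| * |M| * ‖‖t - t₀‖ ^ 2‖ := by
          rw [norm_pow, norm_norm, Real.norm_eq_abs]; ring
  -- assemble: `∫ₐᵗ k(t-s)q = (2) + (1) + (3) - ∫ₐ^{t₀} k(t₀-s)q`
  have hsum := ((h2.add h1).add h3).sub_const (∫ s in a..t₀, k (t₀ - s) * q s)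
  refine (hsum.congr_of_eventuallyEq (Eventually.of_forall fun t => ?_)).congr_deriv
    (by rw [sub_self]; ring)
  have hΦ1 : ∫ s in a..t, k (t₀ - s) * q s =
      (∫ s in a..t₀, k (t₀ - s) * q s) + ∫ s in t₀..t, k (t₀ - s) * q s :=
    (intervalIntegral.integral_add_adjacent_intervals (hint t₀ a t₀) (hint t₀ t₀ t)).symm
  have hΦ3 : ∫ s in t₀..t, (k (t - s) - k (t₀ - s)) * q s =
      (∫ s in t₀..t, k (t - s) * q s) - ∫ s in t₀..t, k (t₀ - s) * q s := by
    rw [← intervalIntegral.integral_sub (hint t t₀ t) (hint t₀ t₀ t)]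
    refine intervalIntegral.integral_congr fun s _ => ?_
    simp only [sub_mul]
  have hΦ2 : (∫ s in a..t₀, k (t - s) * q s) + ∫ s in t₀..t, k (t - s) * q s =
      ∫ s in a..t, k (t - s) * q s :=
    intervalIntegral.integral_add_adjacent_intervals (hint t a t₀) (hint t t₀ t)
  simp only [Pi.add_apply]
  rw [hΦ1, hΦ3, ← hΦ2]
  ring

/-- **Central damping from a pinched logarithmic derivative**: `D⁻ k ≤ -k' ≤ D⁺ k` gives
`|k' + ½(D⁻+D⁺) k| ≤ ½(D⁺-D⁻) k` (pure linear arithmetic). [folklore] -/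
theorem abs_deriv_add_central_mul_le {κ κ' Dl Dh : ℝ} (h1 : Dl * κ ≤ -κ') (h2 : -κ' ≤ Dh * κ) :
    |κ' + (Dl + Dh) / 2 * κ| ≤ (Dh - Dl) / 2 * κ := by
  rw [abs_le]
  constructor <;> linarith

/-! ### The stub -/

/-- **Stub `chainODE`** (L1c-ii of line `Sketch`, abstract kernels). A continuous solution of the
Volterra chain `Y_{i,n}(t) = A 1_{(i,n)=(i₀,n₀)} k_{i,n}(t) + ∫₀ᵗ k_{i,n}(t-s) Q_{i,n}(Y(s)) ds` on
`[0,S)` whose kernels are `C¹` with `k(0) = 1` and a pinched logarithmic derivative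
`D⁻ₙ k ≤ -k' ≤ D⁺ₙ k`, `k ≥ 0` (on `τ ≥ 0`) is differentiable on `(0,S)` and solves the cascade ODE
with the central damping `½(D⁻ₙ+D⁺ₙ)` up to a forcing error controlled by the kernel majorant:
`|Y' + ½(D⁻ₙ+D⁺ₙ) Y − Q| ≤ ½(D⁺ₙ−D⁻ₙ) (|A 1| k(t) + ∫₀ᵗ k(t−s)|Q(s)| ds)`; here
`Y' = A 1 k'(t) + k(0) Q(t) + ∫₀ᵗ k'(t−s) Q(s) ds` by the Leibniz rule
`hasDerivAt_volterra_kernel`. [cite: Tao2016AveragedNS, §4 p. 22 (4.14)] -/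
theorem stub_chainODE :
    ∀ {ε₀ : ℝ}, 0 < ε₀ → ∀ {m : ℕ} (α : Fin m → Fin m → Fin m → ℤ × ℤ × ℤ → ℝ)
      (k k₁ : Fin m → ℤ → ℝ → ℝ) (Dlo Dhi : ℤ → ℝ),
      (∀ i n τ, HasDerivAt (k i n) (k₁ i n τ) τ) → (∀ i n, Continuous (k₁ i n)) →
      (∀ i n, k i n 0 = 1) →
      (∀ (i : Fin m) (n : ℤ) (τ : ℝ), 0 ≤ τ →
        0 ≤ k i n τ ∧ Dlo n * k i n τ ≤ -k₁ i n τ ∧ -k₁ i n τ ≤ Dhi n * k i n τ) →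
      ∀ (i₀ : Fin m) (n₀ : ℤ) (A S : ℝ) (Y : Fin m → ℤ → ℝ → ℝ),
      (∀ i n, ContinuousOn (Y i n) (Ico 0 S)) →
      (∀ (i : Fin m) (n : ℤ), ∀ t ∈ Ico 0 S,
        Y i n t = (if i = i₀ ∧ n = n₀ then A else 0) * k i n t +
          ∫ s in (0 : ℝ)..t, k i n (t - s) * quadTerm ε₀ α Y i n s) →
      ∀ (i : Fin m) (n : ℤ), ∀ t ∈ Ioo 0 S, ∃ y' : ℝ, HasDerivAt (Y i n) y' t ∧
        |y' + (Dlo n + Dhi n) / 2 * Y i n t - quadTerm ε₀ α Y i n t| ≤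
          (Dhi n - Dlo n) / 2 *
            (|(if i = i₀ ∧ n = n₀ then A else 0)| * k i n t +
              ∫ s in (0 : ℝ)..t, k i n (t - s) * |quadTerm ε₀ α Y i n s|) := by
  intro ε₀ _ m α k k₁ Dlo Dhi hk hk₁ hk0 hpinch i₀ n₀ A S Y hY hchain i n t ht
  set a : ℝ := (if i = i₀ ∧ n = n₀ then A else 0) with ha
  set Q : ℝ → ℝ := fun s => quadTerm ε₀ α Y i n s with hQ
  have hQc : ContinuousOn Q (Ico 0 S) := quadTerm_continuousOn α hY i n
  obtain ⟨ht0, htS⟩ := ht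
  -- an intermediate time `t < T < S` and the clamped drive, continuous on `ℝ`
  set T : ℝ := (t + S) / 2 with hT
  have htT : t < T := by rw [hT]; linarith
  have hTS : T < S := by rw [hT]; linarith
  have hT0 : 0 ≤ T := by linarith
  set q : ℝ → ℝ := fun s => Q (max 0 (min T s)) with hq
  have hclamp : ∀ s : ℝ, max 0 (min T s) ∈ Icc 0 T := fun s =>
    ⟨le_max_left _ _, max_le hT0 (min_le_left _ _)⟩
  have hqc : Continuous q :=
    (hQc.mono (Icc_subset_Ico_right hTS)).comp_continuous
      (continuous_const.max (continuous_const.min continuous_id)) hclamp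
  have hq_eq : ∀ s ∈ Icc 0 T, q s = Q s := fun s hs => by
    simp only [hq]
    rw [min_eq_right hs.2, max_eq_right hs.1]
  have hkc : Continuous (k i n) := continuous_iff_continuousAt.2 fun τ => (hk i n τ).continuousAt
  -- the Leibniz rule for the clamped Volterra formula, and transfer to `Y i n` near `t`
  have hF : HasDerivAt (fun u => a * k i n u + ∫ s in (0 : ℝ)..u, k i n (u - s) * q s)
      (a * k₁ i n t + (k i n 0 * q t + ∫ s in (0 : ℝ)..t, k₁ i n (t - s) * q s)) t :=
    ((hk i n t).const_mul a).add (hasDerivAt_volterra_kernel (hk i n) (hk₁ i n) hqc 0 t)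
  have hYF : Y i n =ᶠ[𝓝 t] fun u => a * k i n u + ∫ s in (0 : ℝ)..u, k i n (u - s) * q s := by
    filter_upwards [Ioo_mem_nhds ht0 htT] with u hu
    rw [hchain i n u ⟨hu.1.le, hu.2.trans hTS⟩]
    congr 1
    refine intervalIntegral.integral_congr fun s hs => ?_
    rw [uIcc_of_le hu.1.le] at hs
    rw [hq_eq s ⟨hs.1, hs.2.trans hu.2.le⟩]
  refine ⟨_, hF.congr_of_eventuallyEq hYF, ?_⟩
  -- the damping estimate
  have hQct : ContinuousOn Q (uIcc 0 t) := by
    rw [uIcc_of_le ht0.le]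
    exact hQc.mono (Icc_subset_Ico_right htS)
  have hI0i : IntervalIntegrable (fun s => k i n (t - s) * Q s) volume 0 t :=
    ((hkc.comp (continuous_const.sub continuous_id)).continuousOn.mul hQct).intervalIntegrable
  have hI1i : IntervalIntegrable (fun s => k₁ i n (t - s) * Q s) volume 0 t :=
    (((hk₁ i n).comp (continuous_const.sub continuous_id)).continuousOn.mul hQct).intervalIntegrable
  have hIai : IntervalIntegrable (fun s => (Dhi n - Dlo n) / 2 * (k i n (t - s) * |Q s|)) volume 0 t :=
    (continuousOn_const.mul ((hkc.comp (continuous_const.sub continuous_id)).continuousOn.mul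
      (continuous_abs.comp_continuousOn hQct))).intervalIntegrable
  have hI1 : ∫ s in (0 : ℝ)..t, k₁ i n (t - s) * q s = ∫ s in (0 : ℝ)..t, k₁ i n (t - s) * Q s := by
    refine intervalIntegral.integral_congr fun s hs => ?_
    rw [uIcc_of_le ht0.le] at hs
    rw [hq_eq s ⟨hs.1, hs.2.trans htT.le⟩]
  have hΔ : ∀ τ : ℝ, 0 ≤ τ →
      |k₁ i n τ + (Dlo n + Dhi n) / 2 * k i n τ| ≤ (Dhi n - Dlo n) / 2 * k i n τ := fun τ hτ => by
    obtain ⟨-, h1, h2⟩ := hpinch i n τ hτ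
    exact abs_deriv_add_central_mul_le h1 h2
  have hy : a * k₁ i n t + (k i n 0 * q t + ∫ s in (0 : ℝ)..t, k₁ i n (t - s) * q s) +
      (Dlo n + Dhi n) / 2 * Y i n t - Q t =
      a * (k₁ i n t + (Dlo n + Dhi n) / 2 * k i n t) +
        ∫ s in (0 : ℝ)..t, (k₁ i n (t - s) + (Dlo n + Dhi n) / 2 * k i n (t - s)) * Q s := by
    rw [hI1, hk0 i n, one_mul, hq_eq t ⟨ht0.le, htT.le⟩, hchain i n t ⟨ht0.le, htS⟩]
    have hJ : ∫ s in (0 : ℝ)..t, (k₁ i n (t - s) + (Dlo n + Dhi n) / 2 * k i n (t - s)) * Q s =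
        (∫ s in (0 : ℝ)..t, k₁ i n (t - s) * Q s) +
          (Dlo n + Dhi n) / 2 * ∫ s in (0 : ℝ)..t, k i n (t - s) * Q s := by
      rw [← intervalIntegral.integral_const_mul,
        ← intervalIntegral.integral_add hI1i (hI0i.const_mul _)]
      refine intervalIntegral.integral_congr fun s _ => ?_
      ring
    rw [hJ]
    ring
  rw [hy]
  have hA : |a * (k₁ i n t + (Dlo n + Dhi n) / 2 * k i n t)| ≤
      |a| * ((Dhi n - Dlo n) / 2 * k i n t) := by
    rw [abs_mul]
    exact mul_le_mul_of_nonneg_left (hΔ t ht0.le) (abs_nonneg a)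
  have hB : |∫ s in (0 : ℝ)..t, (k₁ i n (t - s) + (Dlo n + Dhi n) / 2 * k i n (t - s)) * Q s| ≤
      ∫ s in (0 : ℝ)..t, (Dhi n - Dlo n) / 2 * (k i n (t - s) * |Q s|) := by
    rw [← Real.norm_eq_abs]
    refine intervalIntegral.norm_integral_le_of_norm_le ht0.le
      (Eventually.of_forall fun s hs => ?_) hIai
    calc ‖(k₁ i n (t - s) + (Dlo n + Dhi n) / 2 * k i n (t - s)) * Q s‖
        = |k₁ i n (t - s) + (Dlo n + Dhi n) / 2 * k i n (t - s)| * |Q s| := by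
          rw [Real.norm_eq_abs, abs_mul]
      _ ≤ (Dhi n - Dlo n) / 2 * k i n (t - s) * |Q s| :=
          mul_le_mul_of_nonneg_right (hΔ (t - s) (by linarith [hs.2])) (abs_nonneg _)
      _ = (Dhi n - Dlo n) / 2 * (k i n (t - s) * |Q s|) := mul_assoc _ _ _
  calc |a * (k₁ i n t + (Dlo n + Dhi n) / 2 * k i n t) +
          ∫ s in (0 : ℝ)..t, (k₁ i n (t - s) + (Dlo n + Dhi n) / 2 * k i n (t - s)) * Q s|
      ≤ |a * (k₁ i n t + (Dlo n + Dhi n) / 2 * k i n t)| +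
          |∫ s in (0 : ℝ)..t, (k₁ i n (t - s) + (Dlo n + Dhi n) / 2 * k i n (t - s)) * Q s| :=
        abs_add_le _ _
    _ ≤ |a| * ((Dhi n - Dlo n) / 2 * k i n t) +
          ∫ s in (0 : ℝ)..t, (Dhi n - Dlo n) / 2 * (k i n (t - s) * |Q s|) := add_le_add hA hB
    _ = (Dhi n - Dlo n) / 2 * (|a| * k i n t + ∫ s in (0 : ℝ)..t, k i n (t - s) * |Q s|) := by
        rw [intervalIntegral.integral_const_mul]
        ring

end Summit.NavierStokesRegularity.NavierStokesRegularity.Theorems.PerpetualPumpAveragedTypeIBlowup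

end
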